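import Summits.MatrixMultiplication.MatrixMultiplication.Theorems.ObstructionDescentUniversalOccurrenceTwoRectangleHookTableaux

set_option linter.dupNamespace false
set_option autoImplicit false

/-!
# Universal occurrence — two rectangles and TWO COLUMN PAIRS, part D: the pair tableau of `(2N-8,4,2,2)` (decomp-mm · lens 3 · gen 43)

Route `route-MatrixMultiplication-ObstructionDescent` (sub-problem `MatrixMultiplication`, `ω(ℂ) = 2`); SUPPORT for the crux
`NoOccurrenceObstruction` (`P_O`, item `stmt-MatrixMultiplication-29040`) through the universal-occurrence programme (NODE-g29…g43
of the decomp-mm cell, lens 3).  Nothing here proves `ω = 2` or closes an item; no `def`, no `sorry`, standard axioms.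

**Why.**  Parts A–C of this series prove that the three-row non-hook family `((2^N),(2^N),(2N-6,4,2))` occurs for `⟨m⟩`, `m ≥ N ≥ 5`
(`occurs_unitTensor_twoRectangle_fourTwo`), from a twist design with a column pair of height `3` and one of height `2`.  Parts D–F do
the same for the FOUR-row non-hook family `((2^N),(2^N),(2N-8,4,2,2))`, `m ≥ N ≥ 6`, from a pair of height `4` (twisted on two
slots) and a pair of height `2`; again the valid support configurations are twins or anti-twins (part E), the latter even column swaps
of twins, so every term of the floor-law sum is `0` or `+1` (parity law of NODE-g43 §3, `k = 1` of the family `(2N-2k-6,2k+2,2,2)`).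

**This file: the pair tableau `T` of `(2N-8,4,2,2)` and its evaluations.**  `T` reads the diagram column by column: positions
`0,…,3` ↦ column `0` (rows `0,…,3`), `4,…,7` ↦ column `1`, `8,9` ↦ column `2` (rows `0,1`), `10,11` ↦ column `3`, `q ≥ 12` ↦ the arm
cell `(0,q-8)` (`quadPairCell_*`, `mem_youngDiagram_fourTwoTwo`).  A word in the support of `e_T` vanishes on the arm, has letters
`< 4` on columns `0,1`, letters `< 2` on columns `2,3`, and is injective on every column (`quadPairTableau_support`); a word whose
column `1` repeats column `0` and whose column `3` repeats column `2` has `e_T(u) = 1` (`quadPairTableau_twin_eq_one`); and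
`e_T(u ∘ (4 5)(10 11)) = e_T(u)` (`quadPairTableau_evenSwap`).

[cite: BurgisserIkenmeyer2011, §3.4 (Prop. 3.4), Thm. 4.4] [cite: BurgisserIkenmeyer2017, §5, Thm. 5.9 (proof of (2)), eq. (3.4)]
[cite: Landsberg2017, §9.1.1]
-/

noncomputable section

open scoped BigOperators

namespace Summit.MatrixMultiplication.MatrixMultiplication.Theorems.ObstructionCalculus

open Literature.Computability.AlgebraicComplexity
open Literature.NumberTheory.DiophantineGeometry

/-! ### §1 The pair tableau of `(2N-8, 4, 2, 2)` -/

/-- Cells of the pair tableau are distinct. [folklore] -/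
theorem quadPairCell_injective {p q : ℕ}
    (hpq : (if p < 4 then (p, 0) else if p < 8 then (p - 4, 1) else if p < 10 then (p - 8, 2)
        else if p < 12 then (p - 10, 3) else (0, p - 8) : ℕ × ℕ) =
      (if q < 4 then (q, 0) else if q < 8 then (q - 4, 1) else if q < 10 then (q - 8, 2)
        else if q < 12 then (q - 10, 3) else (0, q - 8))) : p = q := by
  split_ifs at hpq <;> simp only [Prod.mk.injEq] at hpq <;> omega

/-- The pair tableau is a standard filling for the position order. [folklore] -/
theorem quadPairCell_standard {p q : ℕ} (hpq : p < q) :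
    ¬ ((if q < 4 then (q, 0) else if q < 8 then (q - 4, 1) else if q < 10 then (q - 8, 2)
        else if q < 12 then (q - 10, 3) else (0, q - 8) : ℕ × ℕ) ≤
      (if p < 4 then (p, 0) else if p < 8 then (p - 4, 1) else if p < 10 then (p - 8, 2)
        else if p < 12 then (p - 10, 3) else (0, p - 8))) := by
  split_ifs <;> simp only [Prod.mk_le_mk] <;> omega

/-- The Young diagram of `(2N-8,4,2,2)`: its boxes. [folklore] -/
theorem mem_youngDiagram_fourTwoTwo {N : ℕ} (ν : Nat.Partition (N * 2))
    (hν : ν.sortedParts = [2 * N - 8, 4, 2, 2]) {r c : ℕ}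
    (h : (r = 0 ∧ c < 2 * N - 8) ∨ (r = 1 ∧ c < 4) ∨ (r = 2 ∧ c < 2) ∨ (r = 3 ∧ c < 2)) :
    (r, c) ∈ ν.youngDiagram := by
  rw [Nat.Partition.mem_youngDiagram_iff, hν]
  rcases h with ⟨rfl, hc⟩ | ⟨rfl, hc⟩ | ⟨rfl, hc⟩ | ⟨rfl, hc⟩
  · exact ⟨by simp, by simpa using hc⟩
  · exact ⟨by simp, by simpa using hc⟩
  · exact ⟨by simp, by simpa using hc⟩
  · exact ⟨by simp, by simpa using hc⟩

/-- `(2N-8,4,2,2)` has four rows. [folklore] -/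
theorem fst_lt_of_mem_youngDiagram_fourTwoTwo {N : ℕ} (ν : Nat.Partition (N * 2))
    (hν : ν.sortedParts = [2 * N - 8, 4, 2, 2]) {x : ℕ × ℕ}
    (hx : x ∈ ν.youngDiagram.cells) : x.1 < 4 := by
  obtain ⟨h, -⟩ := (Nat.Partition.mem_youngDiagram_iff ν x).1 ((YoungDiagram.mem_cells _).1 hx)
  rw [hν] at h
  simpa using h

/-- The cells of the pair tableau lie in `(2N-8,4,2,2)` (`6 ≤ N`). [folklore] -/
theorem quadPairCell_mem_fourTwoTwo {N : ℕ} (hN : 6 ≤ N) (ν : Nat.Partition (N * 2))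
    (hν : ν.sortedParts = [2 * N - 8, 4, 2, 2]) (p : ℕ) (hp : p < N * 2) :
    (if p < 4 then (p, 0) else if p < 8 then (p - 4, 1) else if p < 10 then (p - 8, 2)
        else if p < 12 then (p - 10, 3) else (0, p - 8) : ℕ × ℕ) ∈ ν.youngDiagram := by
  split_ifs with h1 h2 h3 h4 <;> apply mem_youngDiagram_fourTwoTwo ν hν
  · rcases (show p = 0 ∨ p = 1 ∨ p = 2 ∨ p = 3 by omega) with rfl | rfl | rfl | rfl
    · left; constructor <;> omega
    · right; left; constructor <;> omega
    · right; right; left; constructor <;> omega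
    · right; right; right; constructor <;> omega
  · rcases (show p = 4 ∨ p = 5 ∨ p = 6 ∨ p = 7 by omega) with rfl | rfl | rfl | rfl
    · left; constructor <;> omega
    · right; left; constructor <;> omega
    · right; right; left; constructor <;> omega
    · right; right; right; constructor <;> omega
  · rcases (show p = 8 ∨ p = 9 by omega) with rfl | rfl
    · left; constructor <;> omega
    · right; left; constructor <;> omega
  · rcases (show p = 10 ∨ p = 11 by omega) with rfl | rfl
    · left; constructor <;> omega
    · right; left; constructor <;> omega
  · left; constructor <;> omega

/-! ### §2 Support, twins and even swaps -/

/-- **Support of `e_T`.**  If `e_T(u) ≠ 0` then `u` vanishes on the arm, has letters `< 4` on the columns `0, 1` (positions `< 8`),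
letters `< 2` on the columns `2, 3` (positions `8 … 11`), and is injective on every column. [folklore] -/
theorem quadPairTableau_support {N : ℕ} {Y : YoungDiagram} (hN : ∀ x ∈ Y.cells, x.1 < N)
    (T : StdFilling (N * 2) Y)
    (hT : ∀ p : Fin (N * 2), T.1 p = (if (p : ℕ) < 4 then ((p : ℕ), 0) else if (p : ℕ) < 8 then ((p : ℕ) - 4, 1)
      else if (p : ℕ) < 10 then ((p : ℕ) - 8, 2) else if (p : ℕ) < 12 then ((p : ℕ) - 10, 3) else (0, (p : ℕ) - 8)))
    {u : Word N (N * 2)} (hu : T.polytabloid ℂ hN u ≠ 0) :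
    (∀ p : Fin (N * 2), 12 ≤ (p : ℕ) → ((u p : Fin N) : ℕ) = 0) ∧
    (∀ p : Fin (N * 2), (p : ℕ) < 8 → ((u p : Fin N) : ℕ) < 4) ∧
    (∀ p : Fin (N * 2), 8 ≤ (p : ℕ) → (p : ℕ) < 12 → ((u p : Fin N) : ℕ) < 2) ∧
    (∀ p q : Fin (N * 2), (T.1 p).2 = (T.1 q).2 → u p = u q → p = q) := by
  classical
  obtain ⟨σ, hσ, rfl⟩ := StdFilling.exists_of_polytabloid_apply_ne_zero hN T hu
  have hcol : ∀ p, (T.1 (σ p)).2 = (T.1 p).2 := StdFilling.mem_colStab.1 hσ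
  have hval : ∀ p, ((StdFilling.rowWord hN T ∘ ⇑σ) p : ℕ) = (T.1 (σ p)).1 := fun p => rfl
  have hrow' : ∀ q : Fin (N * 2), (T.1 q).1 =
      if (q : ℕ) < 4 then (q : ℕ) else if (q : ℕ) < 8 then (q : ℕ) - 4
      else if (q : ℕ) < 10 then (q : ℕ) - 8 else if (q : ℕ) < 12 then (q : ℕ) - 10 else 0 := fun q => by
    rw [hT]; split_ifs <;> rfl
  have hcol' : ∀ q : Fin (N * 2), (T.1 q).2 =
      if (q : ℕ) < 4 then 0 else if (q : ℕ) < 8 then 1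
      else if (q : ℕ) < 10 then 2 else if (q : ℕ) < 12 then 3 else (q : ℕ) - 8 := fun q => by
    rw [hT]; split_ifs <;> rfl
  refine ⟨fun p hp => ?_, fun p hp => ?_, fun p hp hp' => ?_, fun p q hpq hupq => ?_⟩
  · have hc := hcol p
    rw [hcol', hcol'] at hc
    rw [hval, hrow']
    split_ifs at hc ⊢ <;> omega
  · have hc := hcol p
    rw [hcol', hcol'] at hc
    rw [hval, hrow']
    split_ifs at hc ⊢ <;> omega
  · have hc := hcol p
    rw [hcol', hcol'] at hc
    rw [hval, hrow']
    split_ifs at hc ⊢ <;> omega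
  · have hr : (T.1 (σ p)).1 = (T.1 (σ q)).1 := by
      rw [← hval, ← hval]; exact congrArg Fin.val hupq
    have hc : (T.1 (σ p)).2 = (T.1 (σ q)).2 := by rw [hcol, hcol, hpq]
    exact σ.injective (T.injective (Prod.ext hr hc))

/-- **Twin words evaluate to `1`.**  If `u` vanishes on the arm, is injective with letters `< 4` on column `0` and with letters
`< 2` on column `2`, and columns `1`, `3` repeat the words of columns `0`, `2` (`u (p+4) = u p` for `p < 4`, `u (p+2) = u p` for
`p = 8, 9`), then `e_T(u) = 1`: `u = w_T ∘ ρ` for the column permutation `ρ = ρ₀ · κρ₀κ` (`ρ₀` sorts the columns `0` and `2`,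
`κ` exchanges the columns of each pair row-wise), and `sgn ρ = sgn(ρ₀)² = 1`. [folklore] -/
theorem quadPairTableau_twin_eq_one {N : ℕ} {Y : YoungDiagram} (hN : ∀ x ∈ Y.cells, x.1 < N)
    (T : StdFilling (N * 2) Y)
    (hT : ∀ p : Fin (N * 2), T.1 p = (if (p : ℕ) < 4 then ((p : ℕ), 0) else if (p : ℕ) < 8 then ((p : ℕ) - 4, 1)
      else if (p : ℕ) < 10 then ((p : ℕ) - 8, 2) else if (p : ℕ) < 12 then ((p : ℕ) - 10, 3) else (0, (p : ℕ) - 8)))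
    (hh : 12 ≤ N * 2) {u : Word N (N * 2)}
    (harm : ∀ p : Fin (N * 2), 12 ≤ (p : ℕ) → ((u p : Fin N) : ℕ) = 0)
    (hlt0 : ∀ p : Fin (N * 2), (p : ℕ) < 4 → ((u p : Fin N) : ℕ) < 4)
    (hinj0 : ∀ p q : Fin (N * 2), (p : ℕ) < 4 → (q : ℕ) < 4 → u p = u q → p = q)
    (hlt2 : ∀ p : Fin (N * 2), 8 ≤ (p : ℕ) → (p : ℕ) < 10 → ((u p : Fin N) : ℕ) < 2)
    (hinj2 : ∀ p q : Fin (N * 2), 8 ≤ (p : ℕ) → (p : ℕ) < 10 → 8 ≤ (q : ℕ) → (q : ℕ) < 10 → u p = u q → p = q)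
    (htwin0 : ∀ (p : Fin (N * 2)) (hp : (p : ℕ) < 4), u ⟨p + 4, by omega⟩ = u p)
    (htwin2 : ∀ (p : Fin (N * 2)) (hp : 8 ≤ (p : ℕ)) (hp' : (p : ℕ) < 10), u ⟨p + 2, by omega⟩ = u p) :
    T.polytabloid ℂ hN u = 1 := by
  classical
  have hrow' : ∀ q : Fin (N * 2), (T.1 q).1 =
      if (q : ℕ) < 4 then (q : ℕ) else if (q : ℕ) < 8 then (q : ℕ) - 4
      else if (q : ℕ) < 10 then (q : ℕ) - 8 else if (q : ℕ) < 12 then (q : ℕ) - 10 else 0 := fun q => by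
    rw [hT]; split_ifs <;> rfl
  have hcol' : ∀ q : Fin (N * 2), (T.1 q).2 =
      if (q : ℕ) < 4 then 0 else if (q : ℕ) < 8 then 1
      else if (q : ℕ) < 10 then 2 else if (q : ℕ) < 12 then 3 else (q : ℕ) - 8 := fun q => by
    rw [hT]; split_ifs <;> rfl
  -- `ρ₀`: the permutation of the columns `0` and `2` realising `u` there
  let S := {p : Fin (N * 2) // (p : ℕ) < 4 ∨ (8 ≤ (p : ℕ) ∧ (p : ℕ) < 10)}
  have hS : ∀ x : S, ¬ ((x.1 : Fin (N * 2)) : ℕ) < 4 → 8 ≤ ((x.1 : Fin (N * 2)) : ℕ) ∧ ((x.1 : Fin (N * 2)) : ℕ) < 10 :=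
    fun x hx => by rcases x.2 with h | h <;> omega
  have hb0 : ∀ x : S, ((x.1 : Fin (N * 2)) : ℕ) < 4 → ((u x.1 : Fin N) : ℕ) < N * 2 :=
    fun x hx => by have := hlt0 x.1 hx; omega
  have hb2 : ∀ x : S, ¬ ((x.1 : Fin (N * 2)) : ℕ) < 4 → ((u x.1 : Fin N) : ℕ) + 8 < 10 :=
    fun x hx => by have := hlt2 x.1 (hS x hx).1 (hS x hx).2; omega
  let f₀ : S → S := fun x =>
    if hx : ((x.1 : Fin (N * 2)) : ℕ) < 4 then
      ⟨⟨((u x.1 : Fin N) : ℕ), hb0 x hx⟩, Or.inl (hlt0 x.1 hx)⟩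
    else
      ⟨⟨((u x.1 : Fin N) : ℕ) + 8, by have := hb2 x hx; omega⟩,
        Or.inr ⟨by simp, by have := hb2 x hx; simpa using this⟩⟩
  have hf₀v : ∀ x : S, ((f₀ x).1 : ℕ) =
      if ((x.1 : Fin (N * 2)) : ℕ) < 4 then ((u x.1 : Fin N) : ℕ) else ((u x.1 : Fin N) : ℕ) + 8 := by
    intro x
    by_cases hx : ((x.1 : Fin (N * 2)) : ℕ) < 4
    · simp only [f₀, dif_pos hx, if_pos hx]
    · simp only [f₀, dif_neg hx, if_neg hx]
  have hf₀ : Function.Injective f₀ := by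
    rintro ⟨p, hp⟩ ⟨q, hq⟩ hpq
    have h1 := congrArg (fun x : S => ((x.1 : Fin (N * 2)) : ℕ)) hpq
    simp only [hf₀v] at h1
    apply Subtype.ext
    by_cases hp3 : (p : ℕ) < 4 <;> by_cases hq3 : (q : ℕ) < 4
    · rw [if_pos hp3, if_pos hq3] at h1
      exact hinj0 p q hp3 hq3 (Fin.ext h1)
    · rw [if_pos hp3, if_neg hq3] at h1
      have := hlt0 p hp3; omega
    · rw [if_neg hp3, if_pos hq3] at h1
      have := hlt0 q hq3; omega
    · rw [if_neg hp3, if_neg hq3] at h1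
      exact hinj2 p q (by rcases hp with h | h <;> omega) (by rcases hp with h | h <;> omega)
        (by rcases hq with h | h <;> omega) (by rcases hq with h | h <;> omega) (Fin.ext (by omega))
  let F₀ : Equiv.Perm S := Equiv.ofBijective f₀ (Finite.injective_iff_bijective.1 hf₀)
  let ρ₀ : Equiv.Perm (Fin (N * 2)) := Equiv.Perm.ofSubtype F₀
  have hρ₀_0 : ∀ p : Fin (N * 2), (p : ℕ) < 4 → ((ρ₀ p : Fin (N * 2)) : ℕ) = ((u p : Fin N) : ℕ) := by
    intro p hp
    show ((Equiv.Perm.ofSubtype F₀ p : Fin (N * 2)) : ℕ) = _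
    rw [Equiv.Perm.ofSubtype_apply_of_mem F₀ (Or.inl hp)]
    show (((f₀ ⟨p, Or.inl hp⟩).1 : Fin (N * 2)) : ℕ) = _
    rw [hf₀v, if_pos hp]
  have hρ₀_2 : ∀ p : Fin (N * 2), 8 ≤ (p : ℕ) → (p : ℕ) < 10 →
      ((ρ₀ p : Fin (N * 2)) : ℕ) = ((u p : Fin N) : ℕ) + 8 := by
    intro p hp hp'
    show ((Equiv.Perm.ofSubtype F₀ p : Fin (N * 2)) : ℕ) = _
    rw [Equiv.Perm.ofSubtype_apply_of_mem F₀ (Or.inr ⟨hp, hp'⟩)]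
    show (((f₀ ⟨p, Or.inr ⟨hp, hp'⟩⟩).1 : Fin (N * 2)) : ℕ) = _
    rw [hf₀v, if_neg (by simp; omega)]
  have hρ₀_fix : ∀ p : Fin (N * 2), ¬ ((p : ℕ) < 4 ∨ (8 ≤ (p : ℕ) ∧ (p : ℕ) < 10)) → ρ₀ p = p := fun p hp =>
    Equiv.Perm.ofSubtype_apply_of_not_mem F₀ hp
  -- `κ`: the row-wise exchange of the two columns of each pair
  let kf : Fin (N * 2) → Fin (N * 2) := fun p =>
    if hp : (p : ℕ) < 4 then ⟨p + 4, by omega⟩ else if (p : ℕ) < 8 then ⟨p - 4, by omega⟩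
    else if hp' : (p : ℕ) < 10 then ⟨p + 2, by omega⟩ else if (p : ℕ) < 12 then ⟨p - 2, by omega⟩ else p
  have hkf : ∀ p, ((kf p : Fin (N * 2)) : ℕ) =
      if (p : ℕ) < 4 then (p : ℕ) + 4 else if (p : ℕ) < 8 then (p : ℕ) - 4
      else if (p : ℕ) < 10 then (p : ℕ) + 2 else if (p : ℕ) < 12 then (p : ℕ) - 2 else p := by
    intro p; simp only [kf]; split_ifs <;> rfl
  have hk : Function.Involutive kf := by
    intro p
    apply Fin.ext
    rw [hkf, hkf]
    split_ifs <;> omega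
  let κ : Equiv.Perm (Fin (N * 2)) := Function.Involutive.toPerm kf hk
  have hκ : ∀ p, ((κ p : Fin (N * 2)) : ℕ) =
      if (p : ℕ) < 4 then (p : ℕ) + 4 else if (p : ℕ) < 8 then (p : ℕ) - 4
      else if (p : ℕ) < 10 then (p : ℕ) + 2 else if (p : ℕ) < 12 then (p : ℕ) - 2 else p := hkf
  let ρ : Equiv.Perm (Fin (N * 2)) := ρ₀ * (κ * ρ₀ * κ)
  have hρ : ∀ p, ρ p = ρ₀ (κ (ρ₀ (κ p))) := fun p => rfl
  -- values of `ρ`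
  have hρ_0 : ∀ p : Fin (N * 2), (p : ℕ) < 4 → ((ρ p : Fin (N * 2)) : ℕ) = ((u p : Fin N) : ℕ) := by
    intro p hp
    have h1 : ((κ p : Fin (N * 2)) : ℕ) = p + 4 := by rw [hκ, if_pos hp]
    have h2 : ρ₀ (κ p) = κ p := hρ₀_fix _ (by omega)
    have h3 : κ (κ p) = p := hk p
    rw [hρ, h2, h3]
    exact hρ₀_0 p hp
  have hρ_1 : ∀ (p : Fin (N * 2)) (hp : 4 ≤ (p : ℕ)) (hp' : (p : ℕ) < 8),
      ((ρ p : Fin (N * 2)) : ℕ) = ((u ⟨p - 4, by omega⟩ : Fin N) : ℕ) + 4 := by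
    intro p hp hp'
    have h1 : ((κ p : Fin (N * 2)) : ℕ) = p - 4 := by rw [hκ, if_neg (by omega), if_pos hp']
    have h1' : κ p = ⟨p - 4, by omega⟩ := Fin.ext h1
    have h2 : ((ρ₀ (κ p) : Fin (N * 2)) : ℕ) = ((u ⟨p - 4, by omega⟩ : Fin N) : ℕ) := by
      rw [h1']; exact hρ₀_0 _ (by simp; omega)
    have hu' : ((u ⟨p - 4, by omega⟩ : Fin N) : ℕ) < 4 := hlt0 _ (by simp; omega)
    have h3 : ((κ (ρ₀ (κ p)) : Fin (N * 2)) : ℕ) = ((u ⟨p - 4, by omega⟩ : Fin N) : ℕ) + 4 := by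
      rw [hκ, h2, if_pos hu']
    have h4 : ρ₀ (κ (ρ₀ (κ p))) = κ (ρ₀ (κ p)) := hρ₀_fix _ (by rw [h3]; omega)
    rw [hρ, h4, h3]
  have hρ_2 : ∀ p : Fin (N * 2), 8 ≤ (p : ℕ) → (p : ℕ) < 10 →
      ((ρ p : Fin (N * 2)) : ℕ) = ((u p : Fin N) : ℕ) + 8 := by
    intro p hp hp'
    have h1 : ((κ p : Fin (N * 2)) : ℕ) = p + 2 := by rw [hκ, if_neg (by omega), if_neg (by omega), if_pos hp']
    have h2 : ρ₀ (κ p) = κ p := hρ₀_fix _ (by omega)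
    have h3 : κ (κ p) = p := hk p
    rw [hρ, h2, h3]
    exact hρ₀_2 p hp hp'
  have hρ_3 : ∀ (p : Fin (N * 2)) (hp : 10 ≤ (p : ℕ)) (hp' : (p : ℕ) < 12),
      ((ρ p : Fin (N * 2)) : ℕ) = ((u ⟨p - 2, by omega⟩ : Fin N) : ℕ) + 10 := by
    intro p hp hp'
    have h1 : ((κ p : Fin (N * 2)) : ℕ) = p - 2 := by
      rw [hκ, if_neg (by omega), if_neg (by omega), if_neg (by omega), if_pos hp']
    have h1' : κ p = ⟨p - 2, by omega⟩ := Fin.ext h1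
    have h2 : ((ρ₀ (κ p) : Fin (N * 2)) : ℕ) = ((u ⟨p - 2, by omega⟩ : Fin N) : ℕ) + 8 := by
      rw [h1']; exact hρ₀_2 _ (by simp; omega) (by simp; omega)
    have hu' : ((u ⟨p - 2, by omega⟩ : Fin N) : ℕ) < 2 := hlt2 _ (by simp; omega) (by simp; omega)
    have h3 : ((κ (ρ₀ (κ p)) : Fin (N * 2)) : ℕ) = ((u ⟨p - 2, by omega⟩ : Fin N) : ℕ) + 10 := by
      rw [hκ, h2, if_neg (by omega), if_neg (by omega), if_pos (by omega)]
    have h4 : ρ₀ (κ (ρ₀ (κ p))) = κ (ρ₀ (κ p)) := hρ₀_fix _ (by rw [h3]; omega)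
    rw [hρ, h4, h3]
  have hρ_ge : ∀ p : Fin (N * 2), 12 ≤ (p : ℕ) → ρ p = p := by
    intro p hp
    have h1 : κ p = p := Fin.ext (by rw [hκ]; split_ifs <;> omega)
    have h2 : ρ₀ p = p := hρ₀_fix _ (by omega)
    rw [hρ, h1, h2, h1, h2]
  -- `ρ` is a column permutation and `u = w_T ∘ ρ`
  have hρC : ρ ∈ T.colStab := by
    rw [StdFilling.mem_colStab]
    intro p
    rw [hcol', hcol']
    by_cases h0 : (p : ℕ) < 4
    · have := hρ_0 p h0
      have := hlt0 p h0
      rw [if_pos h0, if_pos (by omega)]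
    · by_cases h1 : (p : ℕ) < 8
      · have := hρ_1 p (by omega) h1
        have := hlt0 ⟨p - 4, by omega⟩ (by simp; omega)
        rw [if_neg h0, if_pos h1, if_neg (by omega), if_pos (by omega)]
      · by_cases h2 : (p : ℕ) < 10
        · have := hρ_2 p (by omega) h2
          have := hlt2 p (by omega) h2
          rw [if_neg h0, if_neg h1, if_pos h2, if_neg (by omega), if_neg (by omega), if_pos (by omega)]
        · by_cases h3 : (p : ℕ) < 12
          · have := hρ_3 p (by omega) h3
            have := hlt2 ⟨p - 2, by omega⟩ (by simp; omega) (by simp; omega)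
            rw [if_neg h0, if_neg h1, if_neg h2, if_pos h3, if_neg (by omega), if_neg (by omega), if_neg (by omega),
              if_pos (by omega)]
          · rw [hρ_ge p (by omega)]
  have hw : u = StdFilling.rowWord hN T ∘ ⇑ρ := by
    funext p
    apply Fin.ext
    show ((u p : Fin N) : ℕ) = (T.1 (ρ p)).1
    rw [hrow']
    by_cases h0 : (p : ℕ) < 4
    · have e1 := hρ_0 p h0
      have := hlt0 p h0
      rw [if_pos (by omega), e1]
    · by_cases h1 : (p : ℕ) < 8
      · have e1 := hρ_1 p (by omega) h1
        have := hlt0 ⟨p - 4, by omega⟩ (by simp; omega)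
        rw [if_neg (by omega), if_pos (by omega), e1, Nat.add_sub_cancel]
        have e2 := htwin0 ⟨p - 4, by omega⟩ (by simp; omega)
        have e3 : (⟨((⟨(p : ℕ) - 4, by omega⟩ : Fin (N * 2)) : ℕ) + 4, by simp; omega⟩ : Fin (N * 2)) = p :=
          Fin.ext (by simp; omega)
        rw [e3] at e2
        rw [e2]
      · by_cases h2 : (p : ℕ) < 10
        · have e1 := hρ_2 p (by omega) h2
          have := hlt2 p (by omega) h2
          rw [if_neg (by omega), if_neg (by omega), if_pos (by omega), e1, Nat.add_sub_cancel]
        · by_cases h3 : (p : ℕ) < 12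
          · have e1 := hρ_3 p (by omega) h3
            have := hlt2 ⟨p - 2, by omega⟩ (by simp; omega) (by simp; omega)
            rw [if_neg (by omega), if_neg (by omega), if_neg (by omega), if_pos (by omega), e1, Nat.add_sub_cancel]
            have e2 := htwin2 ⟨p - 2, by omega⟩ (by simp; omega) (by simp; omega)
            have e3 : (⟨((⟨(p : ℕ) - 2, by omega⟩ : Fin (N * 2)) : ℕ) + 2, by simp; omega⟩ : Fin (N * 2)) = p :=
              Fin.ext (by simp; omega)
            rw [e3] at e2
            rw [e2]
          · rw [hρ_ge p (by omega), if_neg h0, if_neg h1, if_neg h2, if_neg h3]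
            exact harm p (by omega)
  have key := congrFun (StdFilling.wordPerm_polytabloid_of_mem_colStab (k := ℂ) hN T hρC)
    (StdFilling.rowWord hN T)
  rw [wordPerm_apply, ← hw, Pi.smul_apply, StdFilling.polytabloid_apply_rowWord, smul_eq_mul,
    mul_one] at key
  rw [key]
  have hs : Equiv.Perm.sign ρ = 1 := by
    show Equiv.Perm.sign (ρ₀ * (κ * ρ₀ * κ)) = 1
    simp only [Equiv.Perm.sign_mul]
    rcases Int.units_eq_one_or (Equiv.Perm.sign ρ₀) with h1 | h1 <;>
    rcases Int.units_eq_one_or (Equiv.Perm.sign κ) with h2 | h2 <;> simp [h1, h2]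
  rw [hs]
  simp

/-- **Even swaps.**  `e_T(u ∘ q) = e_T(u)` for the even column permutation `q = (4 5)(10 11)` (one transposition inside column
`1`, one inside column `3`). [folklore] -/
theorem quadPairTableau_evenSwap {N : ℕ} {Y : YoungDiagram} (hN : ∀ x ∈ Y.cells, x.1 < N)
    (T : StdFilling (N * 2) Y)
    (hT : ∀ p : Fin (N * 2), T.1 p = (if (p : ℕ) < 4 then ((p : ℕ), 0) else if (p : ℕ) < 8 then ((p : ℕ) - 4, 1)
      else if (p : ℕ) < 10 then ((p : ℕ) - 8, 2) else if (p : ℕ) < 12 then ((p : ℕ) - 10, 3) else (0, (p : ℕ) - 8)))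
    (p4 p5 p10 p11 : Fin (N * 2)) (hp4 : (p4 : ℕ) = 4) (hp5 : (p5 : ℕ) = 5) (hp10 : (p10 : ℕ) = 10)
    (hp11 : (p11 : ℕ) = 11) (u : Word N (N * 2)) :
    T.polytabloid ℂ hN (u ∘ ⇑(Equiv.swap p4 p5 * Equiv.swap p10 p11)) = T.polytabloid ℂ hN u := by
  classical
  have hcol' : ∀ q : Fin (N * 2), (T.1 q).2 =
      if (q : ℕ) < 4 then 0 else if (q : ℕ) < 8 then 1
      else if (q : ℕ) < 10 then 2 else if (q : ℕ) < 12 then 3 else (q : ℕ) - 8 := fun q => by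
    rw [hT]; split_ifs <;> rfl
  set q : Equiv.Perm (Fin (N * 2)) := Equiv.swap p4 p5 * Equiv.swap p10 p11 with hq
  have hqv : ∀ x : Fin (N * 2), ((q x : Fin (N * 2)) : ℕ) =
      if (x : ℕ) = 4 then 5 else if (x : ℕ) = 5 then 4 else if (x : ℕ) = 10 then 11 else if (x : ℕ) = 11 then 10
      else (x : ℕ) := by
    intro x
    rw [hq, Equiv.Perm.mul_apply, Equiv.swap_apply_def, Equiv.swap_apply_def]
    simp only [Fin.ext_iff, hp4, hp5, hp10, hp11]
    split_ifs <;> omega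
  have hqC : q ∈ T.colStab := by
    rw [StdFilling.mem_colStab]
    intro x
    rw [hcol', hcol', hqv]
    split_ifs <;> omega
  have key := congrFun (StdFilling.wordPerm_polytabloid_of_mem_colStab (k := ℂ) hN T hqC) u
  rw [wordPerm_apply, Pi.smul_apply, smul_eq_mul] at key
  rw [key]
  have hs : Equiv.Perm.sign q = 1 := by
    rw [hq, Equiv.Perm.sign_mul, Equiv.Perm.sign_swap (fun h => by rw [Fin.ext_iff, hp4, hp5] at h; omega),
      Equiv.Perm.sign_swap (fun h => by rw [Fin.ext_iff, hp10, hp11] at h; omega)]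
    decide
  rw [hs]
  simp

end Summit.MatrixMultiplication.MatrixMultiplication.Theorems.ObstructionCalculus
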